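import Summits.ABC.IUTFork.DAGL5a
import Summits.ABC.IUTFork.DAGL5b
import Summits.ABC.IUTFork.DAGL5c
import Summits.ABC.IUTFork.DAGL5p
import Summits.ABC.IUTFork.DAGL5q
import Summits.ABC.IUTFork.DAGL5r
import Summits.ABC.IUTFork.DAGL5s
import Summits.ABC.IUTFork.DAGL5t
import Summits.ABC.IUTFork.DAGL5u
import Summits.ABC.IUTFork.DAGL5v
import Summits.ABC.IUTFork.DAGL5w
import Summits.ABC.IUTFork.DAGL5x
import Literature.IUT.HodgeTheaters.GlobalFrobenioidsModel
import Literature.IUT.HodgeTheaters.FPrimeStripsCoric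
import Literature.IUT.HodgeTheaters.PMBaseKit
import Literature.IUT.HodgeTheaters.PuncturedEllipticCoveringsCores

/-!
# Layer-5 certificate, companion `Conditional/Layer5OfSData` — class (b)/(e): the 56 DATA nodes of the L5 cone; class (c): the §1 held row Cor 1.2

Companion of `Conditional/Layer5OfS.lean` (abc-iut cell, director-abc (C2); plan/L5/LAYER5-CERT-SPEC.md v0 §3 (b)/(e)).  The 56 DATA rows
of the 139 [IUTchI] cone rows (definitions / structures / containers — the kernel-index name is an `abbrev` to a non-Prop) contribute
no conjunct at v0; here the kernel checks that each index name `Summit.ABC.IUTFork.DAG.N_IUTchI_<id>` exists (50 rows), and for the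
six rows without an index name at this regeneration of the index (KNIT requested from abc-iut-c312-2) that the underlying declarations
of record exist: Ex5.1(vi) (p404939), Def5.2(vi)/(viii) (p410415 `CoricKit` fields), Def6.1(ii)/(vi)/(vii) (p405271 `PMBaseKit` fields).
Mochizuki, *Inter-universal Teichmüller theory I*, kurims manuscript (May 2020) [cite: Mochizuki2012] (D-0012 claim key; DISPUTED).
This module also carries the HELD §1 row IUTchI:Cor1.2 (`layer5_held_cor12`, class (c): DATA atoms `D D' : PuncturedEllipticData` + 6 LAW
binders ⊢ `D.CharacteristicNatureOfCoverings D'`), kept here so that the two certificate modules are independent of each other's build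
(its 6 binders are counted in the census of `Layer5OfS.lean`).
HONEST FRAMING: nothing in this certificate asserts that abc is proved or refuted or takes a side on [IUTchIII] Cor. 3.12 (nor on [IUTchI]); a binder is an ASSUMPTION LABEL, not an endorsement; typed ≠ discharged; indexed ≠ endorsed; establishment = OUR kernel check only.  Writer: abc-iut-L5-d2 (gen 6).
-/

namespace Summit.ABC.IUTFork.Conditional

open Summit.ABC.IUTFork

noncomputable section

example := @DAG.N_IUTchI_Def1_1  -- IUTchI:Def1.1 · DAGL5b
example := @DAG.N_IUTchI_Ex3_4_i  -- IUTchI:Ex3.4(i) · DAGL5p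
example := @DAG.N_IUTchI_Ex3_4_ii  -- IUTchI:Ex3.4(ii) · DAGL5t
example := @DAG.N_IUTchI_Ex3_4_iii  -- IUTchI:Ex3.4(iii) · DAGL5p
example := @DAG.N_IUTchI_Ex3_5_i  -- IUTchI:Ex3.5(i) · DAGL5p
example := @DAG.N_IUTchI_Ex3_5_ii  -- IUTchI:Ex3.5(ii) · DAGL5p
example := @DAG.N_IUTchI_Ex3_5_iii  -- IUTchI:Ex3.5(iii) · DAGL5p
example := @DAG.N_IUTchI_Cor3_8  -- IUTchI:Cor3.8 · DAGL5q
example := @DAG.N_IUTchI_Cor3_9_i  -- IUTchI:Cor3.9(i) · DAGL5q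
example := @DAG.N_IUTchI_Cor3_9_ii  -- IUTchI:Cor3.9(ii) · DAGL5q
example := @DAG.N_IUTchI_Def4_1_ii  -- IUTchI:Def4.1(ii) · DAGL5a
example := @DAG.N_IUTchI_Def4_1_iii  -- IUTchI:Def4.1(iii) · DAGL5q
example := @DAG.N_IUTchI_Def4_1_vi  -- IUTchI:Def4.1(vi) · DAGL5q
example := @DAG.N_IUTchI_Ex4_3_ii  -- IUTchI:Ex4.3(ii) · DAGL5q
example := @DAG.N_IUTchI_Ex4_3_iii  -- IUTchI:Ex4.3(iii) · DAGL5q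
example := @DAG.N_IUTchI_Def4_6_i  -- IUTchI:Def4.6(i) · DAGL5q
example := @DAG.N_IUTchI_Def4_6_ii  -- IUTchI:Def4.6(ii) · DAGL5q
example := @DAG.N_IUTchI_Def4_6_iii  -- IUTchI:Def4.6(iii) · DAGL5q
example := @DAG.N_IUTchI_Prop4_7_ii  -- IUTchI:Prop4.7(ii) · DAGL5q
example := @DAG.N_IUTchI_Prop4_7_iii  -- IUTchI:Prop4.7(iii) · DAGL5q
example := @DAG.N_IUTchI_Prop4_8_i  -- IUTchI:Prop4.8(i) · DAGL5q
example := @DAG.N_IUTchI_Prop4_8_iii  -- IUTchI:Prop4.8(iii) · DAGL5q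
example := @DAG.N_IUTchI_Prop4_8_iv  -- IUTchI:Prop4.8(iv) · DAGL5q
example := @DAG.N_IUTchI_Ex5_1_ii  -- IUTchI:Ex5.1(ii) · DAGL5r
-- IUTchI:Ex5.1(vi) · no kernel-index name at this regeneration · p404939 GlobalFrobenioidsModel; print (vi) p.130 «the discussion of (iv), (v) … may also be carried out for †F⊚, †D⊚» = the (iv)/(v) containers over an arbitrary G (the representative decl carries the (iv) locator)
example := @Literature.IUT.HodgeTheaters.BirationalData
example := @DAG.N_IUTchI_Def5_2_i  -- IUTchI:Def5.2(i) · DAGL5r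
example := @DAG.N_IUTchI_Def5_2_ii  -- IUTchI:Def5.2(ii) · DAGL5r
example := @DAG.N_IUTchI_Def5_2_iii  -- IUTchI:Def5.2(iii) · DAGL5r
example := @DAG.N_IUTchI_Def5_2_iv  -- IUTchI:Def5.2(iv) · DAGL5r
example := @DAG.N_IUTchI_Def5_2_v  -- IUTchI:Def5.2(v) · DAGL5r
-- IUTchI:Def5.2(vi) · no kernel-index name at this regeneration · p410415 FPrimeStripsCoric, CoricKit fields (vi) pp.136–137
example := @Literature.IUT.HodgeTheaters.PMBaseKit.CoricKit.kummer
example := @Literature.IUT.HodgeTheaters.PMBaseKit.CoricKit.kummer_injective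
example := @DAG.N_IUTchI_Def5_2_vii  -- IUTchI:Def5.2(vii) · DAGL5r
-- IUTchI:Def5.2(viii) · no kernel-index name at this regeneration · p410415 FPrimeStripsCoric, CoricKit fields (viii) pp.140–141
example := @Literature.IUT.HodgeTheaters.PMBaseKit.CoricKit.IsInfkxCoric
example := @Literature.IUT.HodgeTheaters.PMBaseKit.CoricKit.isInfkxCoric_model
example := @DAG.N_IUTchI_Ex5_4_i  -- IUTchI:Ex5.4(i) · DAGL5r
example := @DAG.N_IUTchI_Ex5_4_ii  -- IUTchI:Ex5.4(ii) · DAGL5r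
example := @DAG.N_IUTchI_Ex5_4_v  -- IUTchI:Ex5.4(v) · DAGL5r
example := @DAG.N_IUTchI_Def5_5_i  -- IUTchI:Def5.5(i) · DAGL5r
example := @DAG.N_IUTchI_Def5_5_ii  -- IUTchI:Def5.5(ii) · DAGL5r
example := @DAG.N_IUTchI_Def5_5_iii  -- IUTchI:Def5.5(iii) · DAGL5r
example := @DAG.N_IUTchI_Cor5_6_iii  -- IUTchI:Cor5.6(iii) · DAGL5s
-- IUTchI:Def6.1(ii) · no kernel-index name at this regeneration · p405271 PMBaseKit fields (ii) p.156 (PMBaseStrips p405878 is typed over them)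
example := @Literature.IUT.HodgeTheaters.PMBaseKit.pmObj
example := @Literature.IUT.HodgeTheaters.PMBaseKit.toPM
example := @DAG.N_IUTchI_Def6_1_v  -- IUTchI:Def6.1(v) · DAGL5s
-- IUTchI:Def6.1(vi) · no kernel-index name at this regeneration · p405271 PMBaseKit fields (vi) p.159
example := @Literature.IUT.HodgeTheaters.PMBaseKit.GLab
example := @Literature.IUT.HodgeTheaters.PMBaseKit.gLabMap
-- IUTchI:Def6.1(vii) · no kernel-index name at this regeneration · p405271 PMBaseKit fields (vii) p.159
example := @Literature.IUT.HodgeTheaters.PMBaseKit.atV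
example := @Literature.IUT.HodgeTheaters.PMBaseKit.phiEll
example := @DAG.N_IUTchI_Ex6_2_i  -- IUTchI:Ex6.2(i) · DAGL5s
example := @DAG.N_IUTchI_Ex6_3_i  -- IUTchI:Ex6.3(i) · DAGL5b
example := @DAG.N_IUTchI_Ex6_3_ii  -- IUTchI:Ex6.3(ii) · DAGL5s
example := @DAG.N_IUTchI_Prop6_5_iii  -- IUTchI:Prop6.5(iii) · DAGL5s
example := @DAG.N_IUTchI_Prop6_6_i  -- IUTchI:Prop6.6(i) · DAGL5s
example := @DAG.N_IUTchI_Prop6_6_iv  -- IUTchI:Prop6.6(iv) · DAGL5s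
example := @DAG.N_IUTchI_Prop6_6_v  -- IUTchI:Prop6.6(v) · DAGL5s
example := @DAG.N_IUTchI_Prop6_9_iii  -- IUTchI:Prop6.9(iii) · DAGL5s
example := @DAG.N_IUTchI_Cor6_10_iv  -- IUTchI:Cor6.10(iv) · DAGL5s
example := @DAG.N_IUTchI_Def6_11_iii  -- IUTchI:Def6.11(iii) · DAGL5s
example := @DAG.N_IUTchI_Def6_13_i  -- IUTchI:Def6.13(i) · DAGL5s
example := @DAG.N_IUTchI_Def6_13_ii  -- IUTchI:Def6.13(ii) · DAGL5s

end

open Literature.IUT.HodgeTheaters in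
/-- **Class (c), [IUTchI] §1 — HELD row Cor 1.2 "Characteristic Nature of Coverings".**  DATA binders (interface atoms; no constructor from a
curve in the tree): two §1 data `D D' : PuncturedEllipticData` (abc-iut-L5-t1's interface for `(X/k, C̲, ε̲)`).  LAW binders: the printed
claims of pp. 37–38 and Rmk 1.2.1 for both data (`ArrowCoveringClaims`, `Rmk121`) and the two anabelian core inputs `hX`, `hC` ("`C` is a
`k`-core of `X→`, `C→`": [AbsTopI] Lem. 4.5, [AbsAnab] Lem. 1.3.9 as amended by Rmk 1.2.2 — L4 merge inputs).  Closer BY NAME: abc-iut-L5-d4's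
`PuncturedEllipticData.characteristicNatureOfCoverings_of_core_isos` (p407653).  Conjunct = the typed node predicate
`D.CharacteristicNatureOfCoverings D'`.  Nothing here asserts that abc is proved or refuted or takes a side on [IUTchIII] Cor. 3.12. -/
theorem layer5_held_cor12 (D D' : PuncturedEllipticData) (h : D.ArrowCoveringClaims) (h' : D'.ArrowCoveringClaims)
    (hR : D.Rmk121) (hR' : D'.Rmk121)
    (hX : ∀ φ : D.piXarrow ≃* D'.piXarrow, Continuous φ → Continuous φ.symm →
      ∃ Θ : D.PiC ≃* D'.PiC, Continuous Θ ∧ (∀ x : D.piXarrow, Θ (x : D.PiC) = (φ x : D'.PiC)) ∧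
        (fun K => (K.map D.PiCbar.subtype).map Θ.toMonoidHom) '' D.cuspClassX =
          (fun K' => K'.map D'.PiCbar.subtype) '' D'.cuspClassX ∧
        (fun K => (K.map D.PiCbar.subtype).map Θ.toMonoidHom) '' D.cuspClassC =
          (fun K' => K'.map D'.PiCbar.subtype) '' D'.cuspClassC)
    (hC : ∀ ψ : D.piCarrow ≃* D'.piCarrow, Continuous ψ → Continuous ψ.symm →
      ∃ Θ : D.PiC ≃* D'.PiC, Continuous Θ ∧ (∀ x : D.piCarrow, Θ (x : D.PiC) = (ψ x : D'.PiC)) ∧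
        (fun K => (K.map D.PiCbar.subtype).map Θ.toMonoidHom) '' D.cuspClassC =
          (fun K' => K'.map D'.PiCbar.subtype) '' D'.cuspClassC) :
    D.CharacteristicNatureOfCoverings D' :=  -- IUTchI:Cor1.2
  PuncturedEllipticData.characteristicNatureOfCoverings_of_core_isos h h' hR hR' hX hC

end Summit.ABC.IUTFork.Conditional
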